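import Mathlib
import Summits.Ventures.PercRepro2.Tail2DBlockCalc
import Summits.Ventures.PercRepro2.Tail2DHarrisSP
import Summits.Ventures.PercRepro2.Tail2DFlowOneBlocks
import Summits.Ventures.PercRepro2.Tail2DFlowOnePar
import Summits.Ventures.PercRepro2.Tail2DSDomSwap
import Summits.Ventures.PercRepro2.Tail2DFlowOneStep01
import Summits.Ventures.PercRepro2.Tail2DFlowOneThreeCounts
import Summits.Ventures.PercRepro2.Tail2DRelayBlocks
import Summits.Ventures.PercRepro2.Tail2DRelayWeights

/-!
# The one-factor relay step of (SD) at `(2,0)`: `X ∥ Y` from `Y`, for a flow-one factor `X`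
(seat mine-b, cell pub-perc-repro2; conjectures/MINE-B.md §45)

On `Z = X ∥ Y` with `X` flow-one (letters `R`, `B`, `C` of sizes `a`, `a`, `c`) the tail `E(2,0)` is
`R × E_Y(1,0) ⊔ col × E_Y(2,0)` and the bluer tail `E(1,1)` is `R × E_Y(0,1) ⊔ B × E_Y(1,0) ⊔ C × E_Y(1,1)`.
Split `E_Y(1,0) = E_Y(1,1) ⊔ D_Y(1,0)` with the ROW-TAIL `D_Y(1,0) = {r ≥ 1, b = 0}` (a LOWER set, `rowTail`)
and `E_Y(0,1) = E_Y(1,1) ⊔ Dc_Y(0,1)` with the COLUMN-TAIL `Dc_Y(0,1) = {r = 0, b ≥ 1}` (an UPPER set, `colTail`).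
The RELAY: eight product moves —
`E_Y(1,1) × R` stays, flips (`R ≼ B`) or relaxes (`R ≼ col`);
`D_Y(1,0) × R` is carried to `E_Y(0,1) × R` and to `Dc_Y(0,1) × R` by HARRIS (a lower set against an upper set)
or flips to `D_Y(1,0) × B`;
`E_Y(2,0) × C` moves to `E_Y(1,1) × C` by (SD) of `Y` at `(2,0)`;
`E_Y(2,0) × B` moves to `E_Y(1,0) × B` by the red axis `E_Y(2,0) ≼ E_Y(1,0)` of `Y` —
with weights `relayW` that are non-negative exactly when the tail counts `T₁ = T_Y(1,0)`, `T₁₁ = T_Y(1,1)`,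
`T₂₀ = T_Y(2,0)` of `Y` satisfy `T₁₁ (T₁ + T₂₀) ≥ 2 T₁ T₂₀` and `T₁₁ ≤ 2 T₂₀` (`sdomZ_par_relay_20`).
Both inequalities are inherited along a comb of flow-one factors (`Tail2DRelay20Comb.lean`), so the step gives
(SD) at `(2,0)`, hence at `(1,1)`, on EVERY parallel composition of flow-one factors with arbitrary sizes.
-/

namespace Summit.Ventures.PercRepro2.Tail2D

open V2Closure Finset

section Step

variable (X Y : V2Closure.SP)

/-- the `X`-blocks of the eight source moves -/
def relaySrcX : Fin 8 → Finset X.Conf :=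
  ![rSet X, rSet X, rSet X, rSet X, rSet X, rSet X, cellSet X, bSet X]
/-- the `X`-blocks of the eight target moves -/
def relayTgtX : Fin 8 → Finset X.Conf :=
  ![rSet X, bSet X, colSet X, rSet X, bSet X, rSet X, cellSet X, bSet X]
/-- the `Y`-blocks of the eight source moves -/
def relaySrcY : Fin 8 → Finset Y.Conf :=
  ![tailSet Y 1 1, tailSet Y 1 1, tailSet Y 1 1, rowTail Y, rowTail Y, rowTail Y, tailSet Y 2 0, tailSet Y 2 0]
/-- the `Y`-blocks of the eight target moves -/
def relayTgtY : Fin 8 → Finset Y.Conf :=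
  ![tailSet Y 1 1, tailSet Y 1 1, tailSet Y 1 1, tailSet Y 0 1, rowTail Y, colTail Y, tailSet Y 1 1, tailSet Y 1 0]
/-- the weights, in the counts of `X` and `Y` -/
def relayWXY : Fin 8 → ℚ :=
  relayW ((rSet X).card) ((cellSet X).card) ((rowTail Y).card) (tailCount Y 1 1) (tailCount Y 2 0)

/-- the rational facts shared by the two coverage identities -/
theorem relay_facts (hX : FlowOne X) (ha : 0 < (rSet X).card) (hS : 0 < tailCount Y 1 1) :
    ((rSet X).card : ℚ) ≠ 0 ∧ (tailCount Y 1 1 : ℚ) ≠ 0 ∧ ((rowTail Y).card : ℚ) + tailCount Y 1 1 ≠ 0 ∧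
    ((cellSet X).card : ℚ) + (rSet X).card ≠ 0 ∧
    relayE ((rSet X).card) ((cellSet X).card) ((rowTail Y).card) (tailCount Y 1 1) (tailCount Y 2 0) ≠ 0 ∧
    relayE' ((rSet X).card) ((cellSet X).card) ((rowTail Y).card) (tailCount Y 1 1) ≠ 0 ∧
    (tailCount Y 1 0 : ℚ) = (rowTail Y).card + tailCount Y 1 1 ∧
    (tailCount Y 0 1 : ℚ) = (rowTail Y).card + tailCount Y 1 1 ∧
    ((colTail Y).card : ℚ) = (rowTail Y).card ∧
    ((colSet X).card : ℚ) = (cellSet X).card + (rSet X).card ∧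
    ((bSet X).card : ℚ) = (rSet X).card ∧
    (tailCount (V2Closure.SP.par X Y) 2 0 : ℚ)
      = relayE ((rSet X).card) ((cellSet X).card) ((rowTail Y).card) (tailCount Y 1 1) (tailCount Y 2 0) ∧
    (tailCount (V2Closure.SP.par X Y) 1 1 : ℚ)
      = relayE' ((rSet X).card) ((cellSet X).card) ((rowTail Y).card) (tailCount Y 1 1) := by
  have hB := card_bSet_eq X
  have hcc := card_cellSet_add X hX
  have hD := card_rowTail_add Y
  have hDcD := card_colTail_eq Y
  have hsym := tailCount_symm Y 0 1
  have haq : (0 : ℚ) < (rSet X).card := by exact_mod_cast ha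
  have hccq : (0 : ℚ) ≤ (cellSet X).card := by positivity
  have hDq : (0 : ℚ) ≤ (rowTail Y).card := by positivity
  have hSq : (0 : ℚ) < tailCount Y 1 1 := by exact_mod_cast hS
  have hTq : (0 : ℚ) ≤ tailCount Y 2 0 := by positivity
  have hT10q : (tailCount Y 1 0 : ℚ) = (rowTail Y).card + tailCount Y 1 1 := by exact_mod_cast hD.symm
  have hT01q : (tailCount Y 0 1 : ℚ) = (rowTail Y).card + tailCount Y 1 1 := by rw [hsym]; exact hT10q
  refine ⟨ne_of_gt haq, ne_of_gt hSq, by positivity, by positivity, ne_of_gt (relayE_pos haq hccq hDq hSq hTq),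
    ne_of_gt (relayE'_pos haq hccq hDq hSq), hT10q, hT01q, by exact_mod_cast hDcD, by exact_mod_cast hcc.symm,
    by exact_mod_cast hB, ?_, ?_⟩
  · unfold relayE
    rw [tailCount_par_20_left X Y hX, ← card_colSet X hX, ← hcc]
    push_cast
    rw [hT10q]; ring
  · unfold relayE'
    rw [tailCount_par_11_left X Y hX]
    push_cast
    rw [hT10q, hT01q]; ring

/-- **the source coverage**: `Unif(E(2,0))` is the `relayWXY`-mixture of the source blocks -/
theorem relay_cov_src (hX : FlowOne X) (ha : 0 < (rSet X).card) (hS : 0 < tailCount Y 1 1)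
    (p : (V2Closure.SP.par X Y).Conf) :
    ∑ k, relayWXY X Y k * unifDens (V2Closure.SP.par X Y) (relaySrcX X k ×ˢ relaySrcY Y k) p
      = unifDens _ (tailSet (V2Closure.SP.par X Y) 2 0) p := by
  obtain ⟨ha0, hS0, hDS0, -, hE0, hE'0, -, -, -, -, hBq, hEq, -⟩ := relay_facts X Y hX ha hS
  obtain ⟨x, y⟩ := p
  simp only [Fin.sum_univ_succ, Fin.sum_univ_zero, relaySrcX, relaySrcY, relayWXY, Matrix.cons_val_zero,
    Matrix.cons_val_succ, unifDens_par_prod, unifDens_par_tail, mem_tailSet_iff, mem_rSet, mem_bSet, mem_cellSet,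
    mem_rowTail, ← tailCount_eq_card]
  rcases flowOne_cases X hX x with hx | hx | hx
  · -- `x ∈ R`: the source needs `r_y ≥ 1`
    rcases (show 1 ≤ Y.rLab y ∨ Y.rLab y = 0 by omega) with hr | hr
    · have hc2 : 2 ≤ 1 + Y.rLab y := by omega
      rcases (show 1 ≤ Y.bLab y ∨ Y.bLab y = 0 by omega) with hb | hb
      · have hb0 : Y.bLab y ≠ 0 := by omega
        simp [hx.1, hx.2, hr, hb, hb0, hc2]
        rw [hEq]
        exact relay_srcA ha0 hS0 hDS0 hE0 hE'0
      · have hD0 : ((rowTail Y).card : ℚ) ≠ 0 := by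
          have : 0 < (rowTail Y).card := Finset.card_pos.2 ⟨y, (mem_rowTail Y y).2 ⟨hr, hb⟩⟩
          exact_mod_cast ne_of_gt this
        simp [hx.1, hx.2, hr, hb, hc2]
        rw [hEq]
        exact relay_srcB ha0 hS0 hD0 hDS0 hE0 hE'0
    · simp [hx.1, hx.2, hr]
  · -- `x ∈ B`: the source needs `r_y ≥ 2`
    rcases (show 2 ≤ Y.rLab y ∨ ¬ (2 ≤ Y.rLab y) by omega) with hr | hr
    · have hT0 : (tailCount Y 2 0 : ℚ) ≠ 0 := by
        have : 0 < tailCount Y 2 0 := by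
          rw [tailCount_eq_card]
          exact Finset.card_pos.2 ⟨y, (mem_tailSet_iff Y 2 0 y).2 ⟨hr, Nat.zero_le _⟩⟩
        exact_mod_cast ne_of_gt this
      simp [hx.1, hx.2, hr]
      rw [hEq, hBq]
      exact relay_srcD ha0 hT0 hE0
    · simp [hx.1, hx.2, hr]
  · -- `x ∈ C`: the source needs `r_y ≥ 2`
    have hcc0 : ((cellSet X).card : ℚ) ≠ 0 := by
      have : 0 < (cellSet X).card := Finset.card_pos.2 ⟨x, (mem_cellSet X x).2 hx⟩
      exact_mod_cast ne_of_gt this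
    rcases (show 2 ≤ Y.rLab y ∨ ¬ (2 ≤ Y.rLab y) by omega) with hr | hr
    · have hT0 : (tailCount Y 2 0 : ℚ) ≠ 0 := by
        have : 0 < tailCount Y 2 0 := by
          rw [tailCount_eq_card]
          exact Finset.card_pos.2 ⟨y, (mem_tailSet_iff Y 2 0 y).2 ⟨hr, Nat.zero_le _⟩⟩
        exact_mod_cast ne_of_gt this
      simp [hx.1, hx.2, hr]
      rw [hEq]
      exact relay_srcC hcc0 hT0 hE0
    · simp [hx.1, hx.2, hr]

/-- **the target coverage**: `Unif(E(1,1))` is the `relayWXY`-mixture of the target blocks -/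
theorem relay_cov_tgt (hX : FlowOne X) (ha : 0 < (rSet X).card) (hS : 0 < tailCount Y 1 1)
    (p : (V2Closure.SP.par X Y).Conf) :
    ∑ k, relayWXY X Y k * unifDens (V2Closure.SP.par X Y) (relayTgtX X k ×ˢ relayTgtY Y k) p
      = unifDens _ (tailSet (V2Closure.SP.par X Y) 1 1) p := by
  obtain ⟨ha0, hS0, hDS0, hca0, hE0, hE'0, hT10q, hT01q, hDcq, hColq, hBq, -, hE'q⟩ := relay_facts X Y hX ha hS
  have hDcD := card_colTail_eq Y
  obtain ⟨x, y⟩ := p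
  simp only [Fin.sum_univ_succ, Fin.sum_univ_zero, relayTgtX, relayTgtY, relayWXY, Matrix.cons_val_zero,
    Matrix.cons_val_succ, unifDens_par_prod, unifDens_par_tail, mem_tailSet_iff, mem_rSet, mem_bSet, mem_cellSet,
    mem_colSet, mem_rowTail, mem_colTail, ← tailCount_eq_card]
  rcases flowOne_cases X hX x with hx | hx | hx
  · -- `x ∈ R`: the target needs `b_y ≥ 1`
    rcases (show 1 ≤ Y.bLab y ∨ Y.bLab y = 0 by omega) with hb | hb
    · have hb0 : Y.bLab y ≠ 0 := by omega
      rcases (show 1 ≤ Y.rLab y ∨ Y.rLab y = 0 by omega) with hr | hr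
      · have hr0 : Y.rLab y ≠ 0 := by omega
        simp [hx.1, hx.2, hr, hr0, hb, hb0]
        rw [hE'q, hT01q]
        exact relay_tgtA ha0 hS0 hDS0 hE0 hE'0
      · have hD0 : ((rowTail Y).card : ℚ) ≠ 0 := by
          have : 0 < (colTail Y).card := Finset.card_pos.2 ⟨y, (mem_colTail Y y).2 ⟨hr, hb⟩⟩
          rw [hDcD] at this
          exact_mod_cast ne_of_gt this
        simp [hx.1, hx.2, hr, hb, hb0]
        rw [hE'q, hT01q, hDcq]
        exact relay_tgtB ha0 hS0 hD0 hDS0 hE0 hE'0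
    · simp [hx.1, hx.2, hb]
  · -- `x ∈ B`: the target needs `r_y ≥ 1`
    rcases (show 1 ≤ Y.rLab y ∨ Y.rLab y = 0 by omega) with hr | hr
    · have hr0 : Y.rLab y ≠ 0 := by omega
      rcases (show 1 ≤ Y.bLab y ∨ Y.bLab y = 0 by omega) with hb | hb
      · have hb0 : Y.bLab y ≠ 0 := by omega
        simp [hx.1, hx.2, hr, hr0, hb, hb0]
        rw [hE'q, hT10q, hBq, hColq]
        exact relay_tgtD1 ha0 hS0 hDS0 hca0 hE0 hE'0
      · have hD0 : ((rowTail Y).card : ℚ) ≠ 0 := by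
          have : 0 < (rowTail Y).card := Finset.card_pos.2 ⟨y, (mem_rowTail Y y).2 ⟨hr, hb⟩⟩
          exact_mod_cast ne_of_gt this
        simp [hx.1, hx.2, hr, hr0, hb]
        rw [hE'q, hT10q, hBq]
        exact relay_tgtD2 ha0 hD0 hDS0 hE0 hE'0
    · simp [hx.1, hx.2, hr]
  · -- `x ∈ C`: the target needs `r_y ≥ 1` and `b_y ≥ 1`
    have hcc0 : ((cellSet X).card : ℚ) ≠ 0 := by
      have : 0 < (cellSet X).card := Finset.card_pos.2 ⟨x, (mem_cellSet X x).2 hx⟩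
      exact_mod_cast ne_of_gt this
    rcases (show (1 ≤ Y.rLab y ∧ 1 ≤ Y.bLab y) ∨ ¬ (1 ≤ Y.rLab y ∧ 1 ≤ Y.bLab y) by tauto) with h | h
    · simp [hx.1, hx.2, h.1, h.2]
      rw [hE'q, hColq]
      exact relay_tgtC hcc0 hca0 hS0 hE0 hE'0
    · rcases (show ¬ (1 ≤ Y.rLab y) ∨ ¬ (1 ≤ Y.bLab y) by tauto) with h1 | h1
      · simp [hx.1, hx.2, h1]
      · simp [hx.1, hx.2, h1]

/-- the `X`-dominations of the eight moves: identities, `R ≼ B` (flip), `R ≼ col` (relax) -/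
theorem relay_domX : ∀ k, BlockDom X (relaySrcX X k) (relayTgtX X k) := by
  intro k; fin_cases k
  · show BlockDom X (rSet X) (rSet X); exact blockDom_refl X _
  · show BlockDom X (rSet X) (bSet X); exact dom_r_b X
  · show BlockDom X (rSet X) (colSet X); exact dom_r_col X
  · show BlockDom X (rSet X) (rSet X); exact blockDom_refl X _
  · show BlockDom X (rSet X) (bSet X); exact dom_r_b X
  · show BlockDom X (rSet X) (rSet X); exact blockDom_refl X _
  · show BlockDom X (cellSet X) (cellSet X); exact blockDom_refl X _
  · show BlockDom X (bSet X) (bSet X); exact blockDom_refl X _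

/-- the `Y`-dominations of the eight moves: identities, Harris on the row-tail, (SD) at `(2,0)`, the red axis -/
theorem relay_domY (hY20 : BlockDom Y (tailSet Y 2 0) (tailSet Y 1 1)) (hYax : BlockDom Y (tailSet Y 2 0) (tailSet Y 1 0)) :
    ∀ k, BlockDom Y (relaySrcY Y k) (relayTgtY Y k) := by
  intro k; fin_cases k
  · show BlockDom Y (tailSet Y 1 1) (tailSet Y 1 1); exact blockDom_refl Y _
  · show BlockDom Y (tailSet Y 1 1) (tailSet Y 1 1); exact blockDom_refl Y _
  · show BlockDom Y (tailSet Y 1 1) (tailSet Y 1 1); exact blockDom_refl Y _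
  · show BlockDom Y (rowTail Y) (tailSet Y 0 1)
    exact blockDom_lower_upper Y _ _ (rowTail_lower Y) (tailSet_blue_upper Y 1)
  · show BlockDom Y (rowTail Y) (rowTail Y); exact blockDom_refl Y _
  · show BlockDom Y (rowTail Y) (colTail Y)
    exact blockDom_lower_upper Y _ _ (rowTail_lower Y) (colTail_upper Y)
  · show BlockDom Y (tailSet Y 2 0) (tailSet Y 1 1); exact hY20
  · show BlockDom Y (tailSet Y 2 0) (tailSet Y 1 0); exact hYax

/-- the target of every move with a non-empty source is non-empty -/
theorem relay_nonempty (hX : FlowOne X) (ha : 0 < (rSet X).card) (hS : 0 < tailCount Y 1 1) :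
    ∀ k, 0 < relayWXY X Y k → (relaySrcX X k ×ˢ relaySrcY Y k).Nonempty →
      (relayTgtX X k ×ˢ relayTgtY Y k).Nonempty := by
  obtain ⟨-, -, -, -, hRne, hBne, hColne, -⟩ := counts X hX ha
  have hD := card_rowTail_add Y
  have hDcD := card_colTail_eq Y
  have hsym := tailCount_symm Y 0 1
  have hT11 : (tailSet Y 1 1).Nonempty := by
    rw [← Finset.card_pos, ← tailCount_eq_card]; exact hS
  have hT10 : (tailSet Y 1 0).Nonempty := by
    rw [← Finset.card_pos, ← tailCount_eq_card]; omega
  have hT01 : (tailSet Y 0 1).Nonempty := by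
    rw [← Finset.card_pos, ← tailCount_eq_card]; omega
  intro k _ hne
  match k with
  | 0 =>
    have hne' : (rSet X ×ˢ tailSet Y 1 1).Nonempty := hne
    show (rSet X ×ˢ tailSet Y 1 1).Nonempty
    exact hne'
  | 1 =>
    show (bSet X ×ˢ tailSet Y 1 1).Nonempty
    exact Finset.nonempty_product.2 ⟨hBne, hT11⟩
  | 2 =>
    show (colSet X ×ˢ tailSet Y 1 1).Nonempty
    exact Finset.nonempty_product.2 ⟨hColne, hT11⟩
  | 3 =>
    show (rSet X ×ˢ tailSet Y 0 1).Nonempty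
    exact Finset.nonempty_product.2 ⟨hRne, hT01⟩
  | 4 =>
    show (bSet X ×ˢ rowTail Y).Nonempty
    have hne' : (rSet X ×ˢ rowTail Y).Nonempty := hne
    exact Finset.nonempty_product.2 ⟨hBne, (Finset.nonempty_product.1 hne').2⟩
  | 5 =>
    show (rSet X ×ˢ colTail Y).Nonempty
    have hne' : (rSet X ×ˢ rowTail Y).Nonempty := hne
    refine Finset.nonempty_product.2 ⟨hRne, ?_⟩
    rw [← Finset.card_pos, hDcD, Finset.card_pos]
    exact (Finset.nonempty_product.1 hne').2
  | 6 =>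
    show (cellSet X ×ˢ tailSet Y 1 1).Nonempty
    have hne' : (cellSet X ×ˢ tailSet Y 2 0).Nonempty := hne
    exact Finset.nonempty_product.2 ⟨(Finset.nonempty_product.1 hne').1, hT11⟩
  | 7 =>
    show (bSet X ×ˢ tailSet Y 1 0).Nonempty
    exact Finset.nonempty_product.2 ⟨hBne, hT10⟩

/-- the weights are non-negative under the two count inequalities of `Y` -/
theorem relay_weights_nonneg (ha : 0 < (rSet X).card) (hS : 0 < tailCount Y 1 1)
    (hTS : tailCount Y 2 0 ≤ tailCount Y 1 1) (hS2 : tailCount Y 1 1 ≤ 2 * tailCount Y 2 0)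
    (hΔ : 2 * tailCount Y 1 0 * tailCount Y 2 0 ≤ tailCount Y 1 1 * (tailCount Y 1 0 + tailCount Y 2 0)) :
    ∀ k, 0 ≤ relayWXY X Y k := by
  have hD := card_rowTail_add Y
  have haq : (0 : ℚ) < (rSet X).card := by exact_mod_cast ha
  have hccq : (0 : ℚ) ≤ (cellSet X).card := by positivity
  have hDq : (0 : ℚ) ≤ (rowTail Y).card := by positivity
  have hSq : (0 : ℚ) < tailCount Y 1 1 := by exact_mod_cast hS
  have hTq : (0 : ℚ) ≤ tailCount Y 2 0 := by positivity
  have hTSq : (tailCount Y 2 0 : ℚ) ≤ tailCount Y 1 1 := by exact_mod_cast hTS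
  have hS2q : (tailCount Y 1 1 : ℚ) ≤ 2 * tailCount Y 2 0 := by exact_mod_cast hS2
  have hT10q : (tailCount Y 1 0 : ℚ) = (rowTail Y).card + tailCount Y 1 1 := by exact_mod_cast hD.symm
  have hΔq : 0 ≤ relayΔ ((rowTail Y).card) (tailCount Y 1 1) (tailCount Y 2 0) := by
    unfold relayΔ
    have h : (2 * tailCount Y 1 0 * tailCount Y 2 0 : ℚ)
        ≤ tailCount Y 1 1 * (tailCount Y 1 0 + tailCount Y 2 0) := by exact_mod_cast hΔ
    rw [hT10q] at h
    linarith
  exact relayW_nonneg haq hccq hDq hSq hTq hTSq hS2q hΔq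

/-- **the one-factor relay step of (SD) at `(2,0)`**: on `X ∥ Y` with `X` flow-one (a red crossing), from (SD)
of `Y` at `(2,0)`, the red axis `E_Y(2,0) ≼ E_Y(1,0)` of `Y`, and the two count inequalities
`T₁₁ (T₁ + T₂₀) ≥ 2 T₁ T₂₀` and `T₁₁ ≤ 2 T₂₀` of `Y` (with `T₂₀ ≤ T₁₁`, `0 < T₁₁`) -/
theorem sdomZ_par_relay_20 (hX : FlowOne X) (ha : 0 < (rSet X).card)
    (hY20 : SDomZ Y 2 0) (hYax : SDomZ Y 2 (-1))
    (hS : 0 < tailCount Y 1 1) (hTS : tailCount Y 2 0 ≤ tailCount Y 1 1)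
    (hS2 : tailCount Y 1 1 ≤ 2 * tailCount Y 2 0)
    (hΔ : 2 * tailCount Y 1 0 * tailCount Y 2 0 ≤ tailCount Y 1 1 * (tailCount Y 1 0 + tailCount Y 2 0)) :
    SDomZ (V2Closure.SP.par X Y) 2 0 := by
  rw [sdomZ_iff_blockDom] at hY20 hYax ⊢
  have e1 : ((2 : ℤ)).toNat = 2 := rfl
  have e2 : ((0 : ℤ)).toNat = 0 := rfl
  have e3 : ((2 : ℤ) - 1).toNat = 1 := rfl
  have e4 : ((0 : ℤ) + 1).toNat = 1 := rfl
  have e5 : ((-1 : ℤ)).toNat = 0 := rfl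
  have e6 : ((-1 : ℤ) + 1).toNat = 0 := rfl
  rw [e1, e2, e3, e4] at hY20 ⊢
  rw [e1, e5, e3, e6] at hYax
  exact blockDom_par_of_certificate X Y (relaySrcX X) (relayTgtX X) (relaySrcY Y) (relayTgtY Y) (relayWXY X Y)
    (relay_weights_nonneg X Y ha hS hTS hS2 hΔ) (relay_domX X) (relay_domY Y hY20 hYax)
    (relay_nonempty X Y hX ha hS) _ _ (relay_cov_src X Y hX ha hS) (relay_cov_tgt X Y hX ha hS)

end Step

end Summit.Ventures.PercRepro2.Tail2D
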